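import Mathlib.Analysis.SpecialFunctions.Complex.Arg
import Mathlib.Analysis.SpecialFunctions.Complex.Circle
import Mathlib.Analysis.Normed.Group.AddCircle
import Mathlib.Topology.Instances.AddCircle.Real
import Mathlib.Topology.Maps.Proper.Basic
import HarnessLib

/-!
# Loops descended to the circle and polar extension of families of loops to the plane

Topic: Topology / FourManifolds (infrastructure for coning a disc bounded by a leaf loop with
a fence collar, `TautFoliationsConePositionRel.lean`, `TautFoliationsRadialSquares.lean`). A
family of loops `K t : ℝ → M`, `2π`-periodic in the loop variable and jointly continuous,
descends to a continuous map on `Real.Angle × ℝ` (`continuous_descend`: the map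
`[0, 2π] × ℝ → Real.Angle × ℝ` is proper, hence a quotient map); composed with the angle
`x ↦ arg (x - c₀)` (continuous off `c₀` as a `Real.Angle`, `Complex.continuousAt_arg_coe_angle`)
and a radial parameter, it gives a continuous map on the punctured plane
(`continuousOn_polarMap`): the **polar extension** of the family. A family which is constant
for parameters `≥ s₁` extends continuously over the centre.

* `descend`, `continuous_descend`, `descend_coe` (**proved**);
* `toC`, `ang`, `continuousAt_ang` (**proved**);
* `polarMap`, `continuousOn_polarMap`, `continuousAt_polarMap_centre`, `polarMap_of_ang` (**proved**).

All statements are [folklore].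
-/

noncomputable section

open Set Filter Metric Topology Function Real

namespace Literature.Topology.FourManifolds

namespace SquarePolar

/-- `2π > 0`, as an instance for `AddCircle (2π) = Real.Angle`. [folklore] -/
instance instFactTwoPiPos : Fact (0 < 2 * π) := ⟨Real.two_pi_pos⟩

variable {M : Type*} [TopologicalSpace M] {Y : Type*} [TopologicalSpace Y]

/-! ## Descending periodic families to the circle -/

/-- The family `K`, `2π`-periodic in the first variable, descended to `Real.Angle × Y`.
[folklore] -/
def descend (K : ℝ → Y → M) : Real.Angle × Y → M :=
  fun p ↦ AddCircle.liftIco (2 * π) 0 (fun t ↦ K t p.2) p.1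

omit [TopologicalSpace M] [TopologicalSpace Y] in
/-- Value of the descended family on representatives in `[0, 2π)`. [folklore] -/
theorem descend_coe (K : ℝ → Y → M) {t : ℝ} (ht : t ∈ Ico 0 (2 * π)) (y : Y) :
    descend K ((t : Real.Angle), y) = K t y := by
  show AddCircle.liftIco (2 * π) 0 (fun t ↦ K t y) (t : Real.Angle) = K t y
  exact AddCircle.liftIco_coe_apply (by rw [zero_add]; exact ht)

omit [TopologicalSpace M] [TopologicalSpace Y] in
/-- Value at the end point `2π`. [folklore] -/
theorem descend_two_pi (K : ℝ → Y → M) (y : Y) : descend K (((2 * π : ℝ) : Real.Angle), y) = K 0 y := by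
  have h : ((2 * π : ℝ) : Real.Angle) = ((0 : ℝ) : Real.Angle) := by
    rw [show (2 * π : ℝ) = 0 + 2 * π by ring]
    exact (AddCircle.coe_add_period (2 * π) 0)
  rw [h]
  exact descend_coe K ⟨le_rfl, by positivity⟩ y

/-- **A jointly continuous periodic family descends continuously.** [folklore] -/
theorem continuous_descend {K : ℝ → Y → M} (hK : ContinuousOn (uncurry K) (Icc 0 (2 * π) ×ˢ univ))
    (hper : ∀ y, K 0 y = K (2 * π) y) : Continuous (descend K) := by
  -- the quotient map `[0, 2π] × Y → Real.Angle × Y`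
  set Ξ : Icc (0 : ℝ) (2 * π) × Y → Real.Angle × Y := fun p ↦ (((p.1 : ℝ) : Real.Angle), p.2) with hΞ
  have hmk : Continuous (fun t : ℝ ↦ ((t : ℝ) : Real.Angle)) := AddCircle.continuous_mk' (2 * π)
  have hΞc : Continuous Ξ :=
    (hmk.comp (continuous_subtype_val.comp continuous_fst)).prodMk continuous_snd
  have hΞprop : IsProperMap Ξ := by
    have h1 : IsProperMap (fun t : Icc (0 : ℝ) (2 * π) ↦ ((t : ℝ) : Real.Angle)) :=
      (hmk.comp continuous_subtype_val).isProperMap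
    exact h1.prodMap isProperMap_id
  have hΞsurj : Surjective Ξ := by
    rintro ⟨θ, y⟩
    obtain ⟨t, ht, rfl⟩ : ∃ t ∈ Ico (0 : ℝ) (0 + 2 * π), (t : Real.Angle) = θ :=
      ⟨(AddCircle.equivIco (2 * π) 0 θ : ℝ), (AddCircle.equivIco (2 * π) 0 θ).2, AddCircle.coe_equivIco⟩
    exact ⟨(⟨t, ht.1, by linarith [ht.2]⟩, y), rfl⟩
  have hΞq : IsQuotientMap Ξ := hΞprop.isClosedMap.isQuotientMap hΞc hΞsurj
  rw [hΞq.continuous_iff]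
  -- on representatives the descended family is `K`
  have heq : descend K ∘ Ξ = fun p : Icc (0 : ℝ) (2 * π) × Y ↦ K p.1 p.2 := by
    funext ⟨t, y⟩
    show descend K (((t : ℝ) : Real.Angle), y) = K t y
    rcases eq_or_lt_of_le t.2.2 with h | h
    · rw [h, descend_two_pi, hper]
    · exact descend_coe K ⟨t.2.1, h⟩ y
  rw [heq]
  exact hK.comp_continuous (continuous_subtype_val.prodMap continuous_id) fun p ↦ ⟨p.1.2, mem_univ _⟩

/-! ## The angle about a point of the plane -/

/-- The plane vector from `c₀` to `x` as a complex number. [folklore] -/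
def toC (c₀ x : ℝ × ℝ) : ℂ := Complex.equivRealProdCLM.symm (x - c₀)

/-- `toC` is continuous. [folklore] -/
theorem continuous_toC (c₀ : ℝ × ℝ) : Continuous (toC c₀) :=
  Complex.equivRealProdCLM.symm.continuous.comp (continuous_id.sub continuous_const)

/-- `toC c₀ x = 0` iff `x = c₀`. [folklore] -/
theorem toC_eq_zero_iff {c₀ x : ℝ × ℝ} : toC c₀ x = 0 ↔ x = c₀ := by
  rw [toC, ← sub_eq_zero (a := x)]
  constructor
  · intro h
    exact Complex.equivRealProdCLM.symm.injective (h.trans (map_zero _).symm)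
  · intro h
    rw [h, map_zero]

/-- **The angle** of `x` about `c₀`, in `Real.Angle = ℝ / 2πℤ`. [folklore] -/
def ang (c₀ x : ℝ × ℝ) : Real.Angle := (Complex.arg (toC c₀ x) : Real.Angle)

/-- The angle is continuous off the centre. [folklore] -/
theorem continuousAt_ang {c₀ x : ℝ × ℝ} (hx : x ≠ c₀) : ContinuousAt (ang c₀) x :=
  (Complex.continuousAt_arg_coe_angle (fun h ↦ hx (toC_eq_zero_iff.1 h))).comp (continuous_toC c₀).continuousAt

/-! ## The polar extension of a family of loops -/

variable {c₀ : ℝ × ℝ} {L : ℝ}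

/-- **The polar map** of the family `K` (loops `K · s`, `2π`-periodic, parameter `s`): the point
`x` at distance `r` from `c₀` goes to the loop of parameter `1 - r / L` at the angle of `x`.
[folklore] -/
def polarMap (K : ℝ → ℝ → M) (c₀ : ℝ × ℝ) (L : ℝ) (x : ℝ × ℝ) : M :=
  descend K (ang c₀ x, 1 - dist x c₀ / L)

/-- **Continuity of the polar map off the centre.** [folklore] -/
theorem continuousOn_polarMap {K : ℝ → ℝ → M} (hK : ContinuousOn (uncurry K) (Icc 0 (2 * π) ×ˢ univ))
    (hper : ∀ s, K 0 s = K (2 * π) s) : ContinuousOn (polarMap K c₀ L) {c₀}ᶜ := by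
  intro x hx
  have h1 : ContinuousAt (fun x ↦ (ang c₀ x, 1 - dist x c₀ / L)) x :=
    (continuousAt_ang hx).prodMk ((continuous_const.sub ((continuous_id.dist continuous_const).div_const L)).continuousAt)
  exact ((continuous_descend hK hper).continuousAt.comp h1).continuousWithinAt

/-- **Continuity of the polar map at the centre** when the family is constant for parameters
`≥ s₁`, `s₁ < 1`. [folklore] -/
theorem continuousAt_polarMap_centre {K : ℝ → ℝ → M} (hL : 0 < L) {s₁ : ℝ} (hs₁ : s₁ < 1) {p₀ : M}
    (hconst : ∀ t s, s₁ ≤ s → K t s = p₀) : ContinuousAt (polarMap K c₀ L) c₀ := by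
  -- the polar map is constant on the ball of radius `(1 - s₁) L`
  have hball : ∀ x ∈ ball c₀ ((1 - s₁) * L), polarMap K c₀ L x = p₀ := by
    intro x hx
    rw [mem_ball] at hx
    have hs : s₁ ≤ 1 - dist x c₀ / L := by
      rw [le_sub_comm, div_le_iff₀ hL]; linarith
    show descend K (ang c₀ x, 1 - dist x c₀ / L) = p₀
    obtain ⟨t, ht, hteq⟩ : ∃ t ∈ Ico (0 : ℝ) (0 + 2 * π), (t : Real.Angle) = ang c₀ x :=
      ⟨(AddCircle.equivIco (2 * π) 0 (ang c₀ x) : ℝ), (AddCircle.equivIco (2 * π) 0 _).2, AddCircle.coe_equivIco⟩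
    rw [← hteq, descend_coe K ⟨ht.1, by linarith [ht.2]⟩, hconst _ _ hs]
  have hc₀ : polarMap K c₀ L c₀ = p₀ := hball c₀ (mem_ball_self (by nlinarith))
  refine continuousAt_const.congr (f := fun _ ↦ p₀) ?_
  filter_upwards [isOpen_ball.mem_nhds (mem_ball_self (show 0 < (1 - s₁) * L by nlinarith))] with x hx
  exact (hball x hx).symm

omit [TopologicalSpace M] in
/-- **The polar map at a point of given angle**: the loop of parameter `1 - r / L` at that
angle. [folklore] -/
theorem polarMap_of_ang {K : ℝ → ℝ → M} {x : ℝ × ℝ} {t : ℝ} (ht : t ∈ Ico 0 (2 * π)) (hxt : ang c₀ x = (t : Real.Angle)) :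
    polarMap K c₀ L x = K t (1 - dist x c₀ / L) := by
  show descend K (ang c₀ x, 1 - dist x c₀ / L) = _
  rw [hxt, descend_coe K ht]

end SquarePolar

end Literature.Topology.FourManifolds
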